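import Summits.ABC.IUTFork.Conditional.Cor312LicenceTripleHullCellRefuteMPinned
import Summits.ABC.IUTFork.Cor312GenuineKWildDifferentExact
import Summits.ABC.IUTFork.Cor312GenuineKWildExactTriple
import HarnessLib

/-!
# Branch C / R-W, M LINE: the hull licence FAILS at the own-ideles M-level setting of an abc-triple datum when R-H row 4's column fails at a WILD pole
# `p ∈ {3, 5}` of EXACT unit type (`e = p(p−1)·(p′/gcd(p′,t))·l`, different `(e + e/p − 1)/e`) — the M twin of abc-iut-W-neg-2's K-line engine
# `GenuineK.not_pilotKummerCompatHull_chosen_triple_of_wildUnitCell` (row «W:REF-EXACT-M-TWIN», wild exact part)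

PROOF-ONLY file (D-0012; 0 definitions, 0 `Prop` facts, no instance) of the abc-iut cell — R-W «WINDOW Θ-SIDE INEQUALITY», seat abc-iut-W-neg-1 (gen 6). TAKES NO
SIDE on [IUTchIII] Cor. 3.12 (S. Mochizuki, *Inter-universal Teichmüller theory III*, Cor. 3.12 p. 173–174; Step (xi-f) p. 184) or on any author; «refuted as typed» ≠
«refuted in print». abc-iut-W-neg-2's K-line REFUTED bands at the wild poles with an EXACT unit type (`FreyHullThresholdGenuineWildUnitExactBand191/223`:
`GenuineK.not_pilotKummerCompatHull_chosen_frey289111328125_three_band`, `5 ≤ l ≤ 956537`; `…_frey99794037551104_five_band`, `7 ≤ l ≤ 4079`) had no M twin: abc-iut-w4-d094's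
M wild engine (`FreyHullThresholdGenuineWildM`) is the CLASS-ROBUST δ-cell (Dedekind's `δ = 2e − 1` at `p ∣ A`), which does not reach these bands; the exact different
`(e + e/p − 1)/e` (abc-iut-w5-d180's `GenuineK.differentOrd_kOf_eq_wildUnit_ratPoint`) and the exact type (abc-iut-W-neg-2's `GenuineK.absRamificationIdx_kOf_eq_wildUnit_of_triple`)
are statements about the K FIBRE. THIS FILE: §1 `WRowM.differentOrd_kOfM_of_kFibre` — the different of an M member IS that of the K-fibre point on its place (both local
fields are `RescaledCompletion T.K p ·` at `placeOfM x₀ = placeOf x'`; companion of `WRowM.absRamificationIdx_kOfM_of_kFibre`, `Cor312LicenceTripleHullCellRefuteMPinned`);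
§2 **`WRowM.not_licence_triple_of_cellLt_wildMember`** — this seat's pinned member socket `WRowM.not_licence_triple_of_not_hullCell` (p527646 §1) with the tame different
REPLACED by a pinned exact different `d(K_{x₀}) = d₀/e₀` (`hdiff`) and the cell stated with `D = d₀` in the strict form `hlt0` of the wild K engines (badness, `m_q = P`, exact
radii VERBATIM as in p527646, then abc-iut-w5-d166's `not_licence_settingPrVolSharpM_tOfIdeleData_of_orders` BY NAME); §3 **`GenuineM.not_pilotKummerCompatHull_triple_of_wildUnitCell`**
— the M-LINE TWIN of abc-iut-W-neg-2's K engine, SAME arithmetic interface (`hpq … hcell` VERBATIM with `(pp : ℕ) ↦ p`), concluding `¬ PilotKummerCompatHull` at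
`settingPrVolSharpM T.D … (tOfIdeleData T.D (ideleDataOf T.D T.isVolumeInputOf)) (tqM …)` (pinned reading, every free binder): non-empty fibre, the member's exact type and
different from the K fibre, `v_p(abc) = t` from `p^t ∥ abc`, §2, abc-iut-c312-5's `licence_of_pilotKummerCompatHull` as in `AbcOfSGenuineMHullCellsTriple` (p528325).
HONEST SCOPE: OUR sharp containers and Dupuy–Hilado's typed (Ind1)/(Ind2); STRONGER-THAN-PRINT set-level reading of Step (xi-f); nothing about the printed GLOBAL
inequality, the number-level `Cor22.Cor312AtDatum` or any author's intended hull; typed ≠ proved; instantiated ≠ endorsed; no abc claim. [cite: Mochizuki2012, IUTchI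
Def. 3.1 (e) p. 62, Ex. 3.2 (iv) p. 71; IUTchIII Cor. 3.12 Step (xi-f) p. 184; IUTchIV Prop. 1.1 p. 9, Prop. 1.2 (i)(ii) p. 10, Prop. 1.3 (i) p. 11, Thm. 1.10 p. 22, Cor. 2.2 (ii)
proof (P5) p. 46] [cite: DupuyHilado2025, §3.4, §4.9, §4.12] [cite: SerreLocalFields1979, Ch. III §4 Prop. 10, §6 Prop. 13] [cite: Serre1972, §1.11–§1.12]
[cite: NeukirchANT1999, Ch. II (5.5)] [claim: Mochizuki2012, status: disputed] for every IUT sentence.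
-/

noncomputable section

open Set Function Metric NumberField IsDedekindDomain

namespace Summit.ABC.IUTFork.Conditional

open Thm311 Thm311.Real Cor312 Cor312Vol Cor312Prov Literature.IUT.LogThetaLattice Literature.IUT.LogVolume
  Literature.IUT.HodgeTheaters Literature.IUT.LogVolume.ThetaData Literature.IUT.LogVolume.Cor22
open Literature.NumberTheory.NumberFields Literature.NumberTheory.GaloisRepresentations.Ultrametric
open Literature.NumberTheory.DiophantineGeometry Literature.NumberTheory.DiophantineGeometry.GenEll Summit.ABC.ABC.Theorems
open Summit.ABC.IUTFork.Repair.RH.HullThresholdExact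

/-! ## §1. The different of an M member is that of the K-fibre point on its place -/

/-- **K-fibre → M-member transport of the (normalised) different.** `T` a genuine Θ-volume datum, `u` a finite place of `ℚ` with `p_u = p`; if EVERY K-fibre point `x'`
over `p` has `d(K_{x'}) = ρ`, then EVERY member `x₀ ∈ V̲_u` has `d(K_{x₀}) = ρ`: `placeOfM x₀ = placeOf x'` for `x' := (fibreEquivPlacesOver _ p).symm ⟨placeOfM x₀, _⟩`
and both local fields are `RescaledCompletion T.K p` at that place. [cite: SerreLocalFields1979, Ch. III §4 Prop. 10] [cite: NeukirchANT1999, Ch. II (5.5)] -/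
theorem WRowM.differentOrd_kOfM_of_kFibre {P₀ : NFPoint} {l : ℕ} (T : Cor22.ThetaVolumeDatumAt P₀ l)
    (u : FinitePlace ℚ) (p : ℕ) (hu : ratChar u = p) (hp : p.Prime) {ρ : ℝ}
    (hK : letI := T.instFieldF; letI := T.instNumberFieldF; letI := T.instAlgebraF; letI := T.instFieldK
      letI := T.instNumberFieldK; letI := T.instAlgebraK; letI := T.instFieldFbar; letI := T.instAlgebraFbar
      letI := T.instAlgebraKFbar; letI := T.instIsElliptic
      haveI : Fact p.Prime := ⟨hp⟩
      ∀ x' : (thetaIndex (pilotDataOfK T.D T.K)).Fibre (.inr ⟨p, hp⟩), differentOrd p (kOf (pilotDataOfK T.D T.K) p x') = ρ) :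
    letI := T.instFieldF; letI := T.instNumberFieldF; letI := T.instAlgebraF; letI := T.instFieldK
    letI := T.instNumberFieldK; letI := T.instAlgebraK; letI := T.instFieldFbar; letI := T.instAlgebraFbar
    letI := T.instAlgebraKFbar; letI := T.instIsElliptic
    ∀ x₀ : (thetaIndexOfInitial T.D).Fibre (Val.non u), differentOrd (ratChar u) (kOfM T.D (ratChar u) u (natCast_ratChar_mem u) x₀) = ρ := by
  classical
  letI := T.instFieldF; letI := T.instNumberFieldF; letI := T.instAlgebraF; letI := T.instFieldK
  letI := T.instNumberFieldK; letI := T.instAlgebraK; letI := T.instFieldFbar; letI := T.instAlgebraFbar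
  letI := T.instAlgebraKFbar; letI := T.instIsElliptic
  intro x₀
  subst hu
  haveI hpfact : Fact (ratChar u).Prime := ⟨hp⟩
  set X := pilotDataOfK T.D T.K with hX
  obtain ⟨x', hx'⟩ : ∃ x' : (thetaIndex X).Fibre (.inr ⟨ratChar u, hp⟩), placeOf X (ratChar u) x' = placeOfM T.D u x₀ := by
    refine ⟨(fibreEquivPlacesOver X ⟨ratChar u, hp⟩).symm
      ⟨placeOfM T.D u x₀, placeOfM_mem_placesOver T.D (ratChar u) u (natCast_ratChar_mem u) x₀⟩, ?_⟩
    show (fibreEquivPlacesOver X ⟨ratChar u, hp⟩ ((fibreEquivPlacesOver X ⟨ratChar u, hp⟩).symm _)).1 = _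
    rw [Equiv.apply_symm_apply]
  have key : ∀ (w₁ w₂ : HeightOneSpectrum (𝓞 T.K)) (h₁ : ((ratChar u : ℕ) : 𝓞 T.K) ∈ w₁.asIdeal)
      (h₂ : ((ratChar u : ℕ) : 𝓞 T.K) ∈ w₂.asIdeal), w₁ = w₂ →
      differentOrd (ratChar u) (RescaledCompletion T.K (ratChar u) w₁ h₁) = ρ →
      differentOrd (ratChar u) (RescaledCompletion T.K (ratChar u) w₂ h₂) = ρ := by
    rintro w₁ w₂ h₁ h₂ rfl h; exact h
  exact key _ _ (natCast_mem_placeOf X (ratChar u) x') (natCast_mem_placeOfM T.D (ratChar u) u (natCast_ratChar_mem u) x₀) hx' (hK x')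

/-! ## §2. The pinned member socket with an EXACT different -/

/-- **THE HULL LICENCE FAILS AT THE OWN-IDELES M-LEVEL SETTING OF AN abc-TRIPLE DATUM WHEN R-H ROW 4's COLUMN FAILS AT A MEMBER OF PINNED TYPE AND PINNED DIFFERENT.**
As this seat's `WRowM.not_licence_triple_of_not_hullCell` (p527646 §1: abc triple, genuine datum at `(ratPoint (a/c), l)`, ANY idele datum `r`, `p_u = p ∣ abc`, `p ≠ 2, l`, a member
`x₀ ∈ V̲_u` of type `e₀`, `e₀·v_p(abc) = l·P`, label `i + 1 ≤ (l−1)/2`, turning point `a₀`), but with the different PINNED by hypothesis, `d(K_{x₀}) = d₀/e₀` (`hdiff`; tame: `d₀ = e₀ − 1`;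
W2 unit pole: `d₀ = e₀ + e₀/p − 1`), and the failing cell in the strict form `P − (i+2)(p^{a₀} − a₀e₀) < e₀·⌊((i+1)²P − (i+1)d₀ − (i+2)(⌊e₀/(p−1)⌋+1))/e₀⌋` (`hlt0`). THEN
`¬ Thm311ToCor312.Licence (settingPrVolSharpM T.D hlog (tOfIdeleData T.D r) (tqM … r) …)` — badness, `m_q = P`, exact radii VERBATIM as in p527646, `WRowM.orders_lt_of_not_hullCell`
with `D = d₀`, abc-iut-w5-d166's `not_licence_settingPrVolSharpM_tOfIdeleData_of_orders`. [cite: Mochizuki2012, IUTchI Ex. 3.2 (iv) p. 71; IUTchIII Cor. 3.12 Step (xi-f) p. 184;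
IUTchIV Prop. 1.1 p. 9, Prop. 1.2 (i)(ii) p. 10, Cor. 2.2 (ii) proof (P5) p. 46] [cite: DupuyHilado2025, §3.4, §4.9, §4.12] [claim: Mochizuki2012, status: disputed] -/
theorem WRowM.not_licence_triple_of_cellLt_wildMember {a b c l : ℕ} (habc : IsABCTriple a b c)
    (T : Cor22.ThetaVolumeDatumAt (ratPoint ((a : ℚ) / c)) l) (u : FinitePlace ℚ) (p : ℕ) (hu : ratChar u = p)
    (hp2 : p ≠ 2) (hpl : p ≠ l) (hpabc : p ∣ a * b * c) {e₀ P i a₀ d₀ : ℕ}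
    (x₀ : letI := T.instFieldF; letI := T.instNumberFieldF; letI := T.instAlgebraF; letI := T.instFieldK
      letI := T.instNumberFieldK; letI := T.instAlgebraK; letI := T.instFieldFbar; letI := T.instAlgebraFbar
      letI := T.instAlgebraKFbar; letI := T.instIsElliptic
      (thetaIndexOfInitial T.D).Fibre (Val.non u))
    (hloc : letI := T.instFieldF; letI := T.instNumberFieldF; letI := T.instAlgebraF; letI := T.instFieldK
      letI := T.instNumberFieldK; letI := T.instAlgebraK; letI := T.instFieldFbar; letI := T.instAlgebraFbar
      letI := T.instAlgebraKFbar; letI := T.instIsElliptic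
      absRamificationIdx (ratChar u) (kOfM T.D (ratChar u) u (natCast_ratChar_mem u) x₀) = e₀)
    (hdiff : letI := T.instFieldF; letI := T.instNumberFieldF; letI := T.instAlgebraF; letI := T.instFieldK
      letI := T.instNumberFieldK; letI := T.instAlgebraK; letI := T.instFieldFbar; letI := T.instAlgebraFbar
      letI := T.instAlgebraKFbar; letI := T.instIsElliptic
      differentOrd (ratChar u) (kOfM T.D (ratChar u) u (natCast_ratChar_mem u) x₀) =
        (d₀ : ℝ) / (absRamificationIdx (ratChar u) (kOfM T.D (ratChar u) u (natCast_ratChar_mem u) x₀) : ℝ))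
    (hP : e₀ * (a * b * c).factorization p = l * P) (hi : i + 1 ≤ (l - 1) / 2)
    (hlo : ∀ t : ℕ, t < a₀ → (1 : ℤ) * (p : ℤ) ^ t * ((p : ℤ) - 1) < (e₀ : ℤ))
    (hhi : (e₀ : ℤ) ≤ 1 * (p : ℤ) ^ a₀ * ((p : ℤ) - 1))
    (hlt0 : ((P : ℕ) : ℤ) - (((i : ℕ) : ℤ) + 1 + 1) * (((p : ℕ) : ℤ) ^ a₀ - (a₀ : ℤ) * ((e₀ : ℕ) : ℤ)) <
      ((e₀ : ℕ) : ℤ) * (((((i : ℕ) : ℤ) + 1) ^ 2 * ((P : ℕ) : ℤ) - (((i : ℕ) : ℤ) + 1) * ((d₀ : ℕ) : ℤ)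
        - (((i : ℕ) : ℤ) + 1 + 1) * (((e₀ / (p - 1) + 1 : ℕ)) : ℤ)) / ((e₀ : ℕ) : ℤ))) :
    letI := T.instFieldF; letI := T.instNumberFieldF; letI := T.instAlgebraF; letI := T.instFieldK
    letI := T.instNumberFieldK; letI := T.instAlgebraK; letI := T.instFieldFbar; letI := T.instAlgebraFbar
    letI := T.instAlgebraKFbar; letI := T.instIsElliptic
    ∀ {logvK : PadicLogsVal T.K} (hlog : LogvAnalyticVal logvK) (r : ThetaData.IdeleData T.D) (M : Type) [Field M] [NumberField M]
      (archPk : ∀ (j : (thetaIndexOfInitial T.D).Label) (vQ : (thetaIndexOfInitial T.D).VQ),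
        Set ((logShellsOfInitialDH T.D logvK).Packet j vQ))
      (archSub : ∀ (j : (thetaIndexOfInitial T.D).Label) (v : (thetaIndexOfInitial T.D).V),
        Set ((logShellsOfInitialDH T.D logvK).Packet j ((thetaIndexOfInitial T.D).over v)))
      (Ψ : ℤ → ∀ v : (thetaIndexOfInitial T.D).V, v ∈ (thetaIndexOfInitial T.D).Vbad →
        Set ((logShellsOfInitialDH T.D logvK).StarPacket v))
      (act : ℤ → ∀ v : (thetaIndexOfInitial T.D).V, v ∈ (thetaIndexOfInitial T.D).Vbad →
        (logShellsOfInitialDH T.D logvK).StarPacket v → Module.End ℚ ((logShellsOfInitialDH T.D logvK).StarPacket v))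
      (Mmod : ℤ → ∀ j : (thetaIndexOfInitial T.D).LabelStar, Set ((logShellsOfInitialDH T.D logvK).GlobalPacket j.1))
      (region : ℤ → ∀ j : (thetaIndexOfInitial T.D).LabelStar, FinDivisor M → ∀ vQ : (thetaIndexOfInitial T.D).VQ,
        Set ((logShellsOfInitialDH T.D logvK).Packet j.1 vQ))
      (n : ℤ) {HT : Type} {LogLink : HT → HT → Type} {IsFull : ∀ {s t : HT}, LogLink s t → Prop}
      (lat : LGPGaussianLogThetaLattice LogLink IsFull)
      {Frd : Type} {IsoF : Frd → Frd → Type} {Ob : Frd → Type} {realify : Frd → Frd} {Strip : Type}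
      {IsoS : Strip → Strip → Type}
      {Mv : ∀ v : (thetaIndexOfInitial T.D).V, v ∈ (thetaIndexOfInitial T.D).Vbad → Type} [∀ v h, Monoid (Mv v h)]
      (sig : GlobalLGPFrobenioidSignature (thetaIndexOfInitial T.D).lstar (thetaIndexOfInitial T.D).V
        (· ∈ (thetaIndexOfInitial T.D).Vbad) Frd IsoF Ob realify Strip IsoS Mv)
      (split : SplittingMonoids Mv) {ObΔ : Type}
      {N : ∀ v : (thetaIndexOfInitial T.D).V, v ∈ (thetaIndexOfInitial T.D).Vbad → Type} [∀ v h, Monoid (N v h)]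
      (qData : QPilotData ObΔ N)
      (htq0 : ∀ (u : FinitePlace ℚ) (x : (thetaIndexOfInitial T.D).Fibre (Val.non u)),
        tqM T.D (ratChar u) u (natCast_ratChar_mem u) r x ≠ 0)
      (Sq : Finset (FinitePlace ℚ))
      (htq1 : ∀ (u : FinitePlace ℚ) (x : (thetaIndexOfInitial T.D).Fibre (Val.non u)), u ∉ Sq →
        ‖tqM T.D (ratChar u) u (natCast_ratChar_mem u) r x‖ = 1),
      ¬ Thm311ToCor312.Licence
        (settingPrVolSharpM T.D hlog (tOfIdeleData T.D r) (fun u x => tqM T.D (ratChar u) u (natCast_ratChar_mem u) r x) M archPk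
          archSub Ψ act Mmod region n lat sig split qData htq0 Sq htq1) := by
  classical
  letI := T.instFieldF; letI := T.instNumberFieldF; letI := T.instAlgebraF; letI := T.instFieldK
  letI := T.instNumberFieldK; letI := T.instAlgebraK; letI := T.instFieldFbar; letI := T.instAlgebraFbar
  letI := T.instAlgebraKFbar; letI := T.instIsElliptic
  intro logvK hlog r M _ _ archPk archSub Ψ act Mmod region n HT LogLink IsFull lat Frd IsoF Ob realify Strip IsoS Mv _ sig split ObΔ N _
    qData htq0 Sq htq1
  subst hu
  haveI hpfact : Fact (ratChar u).Prime := inferInstance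
  have hp : (ratChar u).Prime := hpfact.out
  set K₀ := kOfM T.D (ratChar u) u (natCast_ratChar_mem u) x₀ with hK₀
  -- numerics
  have hp1 : 1 < ratChar u := hp.one_lt
  have hq0 : 0 < ratChar u - 1 := by omega
  have hp1r : (1 : ℝ) < ((ratChar u : ℕ) : ℝ) := by exact_mod_cast hp1
  have hp0r : (0 : ℝ) < ((ratChar u : ℕ) : ℝ) := by linarith
  have ha : 0 < a := habc.1
  have hb : 0 < b := habc.2.1
  have hc : 0 < c := by have := habc.2.2.1; omega
  have habc0 : a * b * c ≠ 0 := by positivity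
  set v : ℕ := (a * b * c).factorization (ratChar u) with hvdef
  have hv : 0 < v := Nat.Prime.factorization_pos_of_dvd hp habc0 hpabc
  have hl5 : 5 ≤ l := T.D.five_le_l
  have hlstar : (thetaIndexOfInitial T.D).lstar = (l - 1) / 2 := rfl
  have hil : i < (thetaIndexOfInitial T.D).lstar := by rw [hlstar]; omega
  -- the local type at the member
  have he0 : 0 < e₀ := by rw [← hloc]; exact absRamificationIdx_pos (ratChar u) _
  have he0r : (0 : ℝ) < (e₀ : ℝ) := by exact_mod_cast he0
  -- the pole of `j(a/c)` below `u`, and the badness of the member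
  have hjF : T.E.j = ((jInv ((a : ℚ) / c) : ℚ) : T.F) := by rw [T.j_eq]; exact eq_ratCast _ _
  have hpole : ∀ w : HeightOneSpectrum (𝓞 ℚ), Rat.HeightOneSpectrum.natGenerator w = ratChar u →
      ord ℚ w (jInv ((a : ℚ) / c)) = -(2 * ((v : ℕ) : ℤ)) := by
    intro w hw
    rw [Cor22.ord_jInv_ratPoint_triple_eq habc w (by rw [hw]; exact hp2) (by rw [hw]; exact hpabc), hw]
  have hord : ∀ w : HeightOneSpectrum (𝓞 ℚ), Rat.HeightOneSpectrum.natGenerator w = ratChar u →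
      ord ℚ w (Cor22.jInv ((a : ℚ) / c)) ≤ -((1 : ℕ) : ℤ) := by
    intro w hw
    rw [hpole w hw]
    have : (0 : ℤ) < v := by exact_mod_cast hv
    push_cast
    linarith
  obtain ⟨hS, -⟩ := placeModOfM_mem_S_and_norm_tqM_le_of_ratPoint T.D (ratChar u) u (natCast_ratChar_mem u) r
    ((a : ℚ) / c) T.j_eq T.isP5Choice x₀ hp2 hpl 1 le_rfl hord
  -- a norm uniformiser of `K_{x₀}` and the integer order `m_q` of the q-idele; its value `m_q = P`
  obtain ⟨ϖ, hϖ, -⟩ := exists_isUniformizer_rescaledCompletion T.K (ratChar u) (placeOfM T.D u x₀)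
    (natCast_mem_placeOfM T.D (ratChar u) u (natCast_ratChar_mem u) x₀)
  obtain ⟨mq, hmq⟩ := exists_int_norm_tqM_eq_zpow T.D (ratChar u) u (natCast_ratChar_mem u) r x₀ hϖ
  have hval := two_mul_l_mul_order_tqM_eq_of_j_eq T.D (ratChar u) u (natCast_ratChar_mem u) r x₀ hS (jInv ((a : ℚ) / c)) hjF hϖ hmq
  have hordu := hpole _ (natGenerator_finBelow_placeModOfM T.D (ratChar u) u (natCast_ratChar_mem u) x₀)
  have hmqP : mq = (P : ℤ) := by
    rw [hordu] at hval
    change (2 * l : ℤ) * mq = -(absRamificationIdx (ratChar u) K₀ : ℤ) * -(2 * ((v : ℕ) : ℤ)) at hval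
    rw [hloc] at hval
    have hPZ : ((e₀ : ℤ)) * (v : ℤ) = (l : ℤ) * (P : ℤ) := by exact_mod_cast hP
    have hl0 : (0 : ℤ) < 2 * (l : ℤ) := by
      have : (0 : ℤ) < (l : ℤ) := by exact_mod_cast (show 0 < l by omega)
      linarith
    have h2 : (2 * l : ℤ) * mq = (2 * l : ℤ) * (P : ℤ) := by
      rw [hval]; linear_combination (2 : ℤ) * hPZ
    exact mul_left_cancel₀ hl0.ne' h2
  -- the EXACT inner and outer radii of `log_p(𝒪^×_{K_{x₀}})`, with their integer exponents
  obtain ⟨cin, ϖ', w, hcin0, hin, hϖ', hw, hwle⟩ := HexHullThreshold.exists_innerRadius (ratChar u) K₀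
  obtain ⟨cout, houtΛ, hcout0, hdom⟩ := HexHullThreshold.exists_outerRadius (ratChar u) K₀
  obtain ⟨Rin, hRin⟩ := hϖ.2 (Units.mk0 cin hcin0)
  obtain ⟨Rout, hRout⟩ := hϖ.2 (Units.mk0 cout hcout0)
  rw [Units.val_mk0] at hRin hRout
  have hϖnorm : ‖(ϖ : K₀)‖ = ((ratChar u : ℕ) : ℝ) ^ (-(1 / (e₀ : ℝ))) := by
    rw [norm_eq_rpow_of_isUniformizer (ratChar u) K₀ hϖ, hloc]
  have hzpow : ∀ m : ℤ, ‖(ϖ : K₀)‖ ^ m = ((ratChar u : ℕ) : ℝ) ^ (-((m : ℝ) / (e₀ : ℝ))) := by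
    intro m
    rw [hϖnorm, ← Real.rpow_intCast, ← Real.rpow_mul hp0r.le]
    congr 1
    ring
  -- `R_in ≤ ⌊e₀/(p−1)⌋ + 1`
  have hRinle : Rin ≤ ((e₀ / (ratChar u - 1) + 1 : ℕ) : ℤ) := by
    have hr : 1 / (((ratChar u : ℕ) : ℝ) - 1) < ((((e₀ / (ratChar u - 1) + 1 : ℕ) : ℤ)) : ℝ) /
        (absRamificationIdx (ratChar u) K₀ : ℝ) := by
      rw [hloc]
      have hq : e₀ < (ratChar u - 1) * (e₀ / (ratChar u - 1) + 1) := Nat.lt_mul_div_succ e₀ hq0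
      have hqr : (e₀ : ℝ) < (((ratChar u - 1 : ℕ)) : ℝ) * (((e₀ / (ratChar u - 1) + 1 : ℕ)) : ℝ) := by exact_mod_cast hq
      have hsub : (((ratChar u - 1 : ℕ)) : ℝ) = ((ratChar u : ℕ) : ℝ) - 1 := by
        rw [Nat.cast_sub hp1.le, Nat.cast_one]
      rw [hsub] at hqr
      have hq0r : (0 : ℝ) < ((ratChar u : ℕ) : ℝ) - 1 := by linarith
      rw [lt_div_iff₀ he0r, one_div, inv_mul_lt_iff₀ hq0r]
      simp only [Int.cast_natCast]
      exact hqr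
    have h := HexHullThreshold.rpow_le_norm_of_innerRadius (ratChar u) K₀ hϖ' hw hwle hr
    rw [hloc, hRin, hzpow] at h
    have h' := (Real.rpow_le_rpow_left_iff hp1r).mp h
    rw [neg_le_neg_iff, div_le_div_iff_of_pos_right he0r] at h'
    exact_mod_cast h'
  -- `R_out ≥ p^{a₀} − a₀·e₀`
  have hRoutge : ((ratChar u : ℕ) : ℤ) ^ a₀ - (a₀ : ℤ) * (e₀ : ℤ) ≤ Rout := by
    have hlo' : ∀ t < a₀, (1 : ℤ) * ((ratChar u : ℕ) : ℤ) ^ t * ((((ratChar u : ℕ)) : ℤ) - 1) <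
        absRamificationIdx (ratChar u) K₀ := by rw [hloc]; exact fun t ht => hlo t ht
    have hhi' : (absRamificationIdx (ratChar u) K₀ : ℤ) ≤ 1 * (((ratChar u : ℕ)) : ℤ) ^ a₀ * ((((ratChar u : ℕ)) : ℤ) - 1) := by
      rw [hloc]; exact hhi
    have h := HexHullThreshold.norm_le_rpow_of_mem_logUnits_turning (ratChar u) K₀ hlo' hhi' houtΛ
    rw [hloc, hRout, hzpow] at h
    have h' := (Real.rpow_le_rpow_left_iff hp1r).mp h
    push_cast at h'
    rw [neg_div, neg_le_neg_iff, div_le_div_iff_of_pos_right he0r] at h'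
    exact_mod_cast h'
  -- the integer test of abc-iut-w5-d166 fails at `(u, i, x₀)`
  have hlt : mq < (absRamificationIdx (ratChar u) K₀ : ℤ) *
        ((mq * ((((i : ℕ) + 1) ^ 2 : ℕ) : ℤ) - ((i : ℕ) + 1 : ℕ) * (d₀ : ℤ) - ((i : ℕ) + 2 : ℕ) * Rin) /
          (absRamificationIdx (ratChar u) K₀ : ℤ)) + ((i : ℕ) + 2 : ℕ) * Rout := by
    rw [hloc, hmqP]
    have he0Z : (0 : ℤ) < (e₀ : ℤ) := by exact_mod_cast he0
    have hneg : ¬ ((e₀ : ℤ) * ((((i : ℤ) + 1) ^ 2 * (P : ℤ) - ((i : ℤ) + 1) * (d₀ : ℤ) -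
        ((i : ℤ) + 1 + 1) * (((e₀ / (ratChar u - 1) + 1 : ℕ)) : ℤ)) / (e₀ : ℤ)) ≤
        (P : ℤ) - ((i : ℤ) + 1 + 1) * ((((ratChar u : ℕ)) : ℤ) ^ a₀ - (a₀ : ℤ) * (e₀ : ℤ))) := not_le.mpr hlt0
    have hcell := WRowM.orders_lt_of_not_hullCell (m := (P : ℤ)) (j := (i : ℤ) + 1) (D := (d₀ : ℤ)) he0Z (by positivity)
      hRinle hRoutge hneg
    push_cast
    have hj2 : ((i : ℤ) + 2) = ((i : ℤ) + 1) + 1 := by ring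
    rw [hj2]
    convert hcell using 3
  exact not_licence_settingPrVolSharpM_tOfIdeleData_of_orders T.D hlog r M archPk archSub Ψ act Mmod region n lat sig split qData htq0 Sq
    htq1 u ⟨i, hil⟩ x₀ hϖ hdiff hin ⟨ϖ', w, hϖ', hw, hwle⟩ houtΛ hdom hRin hRout hmq hlt

/-! ## §3. The M twin of the K-line exact wild-unit engine -/

/-- **M-LINE TWIN of abc-iut-W-neg-2's `GenuineK.not_pilotKummerCompatHull_chosen_triple_of_wildUnitCell`, SAME arithmetic interface** (`p_u = p ∈ {3, 5}`, `p′` the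
other one, `p ≠ l`, `p^t ∥ abc` with `p ∣ t`, the unit test `p ∥ D` (`hD1`/`hD2`), a label, and at the ONE exact type `A = p(p−1)·(p′/gcd(p′,t))` a turning point with the strict
W2 cell, `D = Al + Al/p − 1`): at the own-ideles M-level setting (analytic `logv`, pinned reading, every free binder) `¬ PilotKummerCompatHull` — non-empty fibre; the member's
type `A·l` (`GenuineK.absRamificationIdx_kOf_eq_wildUnit_of_triple` via `WRowM.absRamificationIdx_kOfM_of_kFibre`) and different `(Al + Al/p − 1)/(Al)`
(`GenuineK.differentOrd_kOf_eq_wildUnit_ratPoint` at `RadTriple.ord_jInv_eq_neg_two_mul` / `RadTriple.unit_test_of_dvd_of_not_sq_dvd`, via §1); `v_p(abc) = t`; §2;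
`licence_of_pilotKummerCompatHull`. [cite: Mochizuki2012, IUTchIII Cor. 3.12 Step (xi-f) p. 184; IUTchIV Prop. 1.2 (i)(ii) p. 10, Prop. 1.3 (i) p. 11, Thm. 1.10 p. 22]
[cite: DupuyHilado2025, §3.4, §4.9, §4.12] [cite: SerreLocalFields1979, Ch. III §6 Prop. 13] [claim: Mochizuki2012, status: disputed] -/
theorem GenuineM.not_pilotKummerCompatHull_triple_of_wildUnitCell {a b c : ℕ} (habc : IsABCTriple a b c) {l : ℕ}
    (T : Cor22.ThetaVolumeDatumAt (ratPoint ((a : ℚ) / c)) l) (u : FinitePlace ℚ) (p : ℕ) (hu : ratChar u = p) {p' : ℕ}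
    (hpq : (p = 3 ∧ p' = 5) ∨ (p = 5 ∧ p' = 3)) (hpl : p ≠ l) {t : ℕ} (ht : 0 < t)
    (hdvd : p ^ t ∣ a * b * c) (hndvd : ¬ p ^ (t + 1) ∣ a * b * c) (hpt : p ∣ t)
    (hD1 : (p : ℤ) ∣ (((a * b * c / p ^ t : ℕ) : ℤ) ^ 2) ^ (p - 1) - ((256 * (c * b + a * a) ^ 3 : ℕ) : ℤ) ^ (p - 1))
    (hD2 : ¬ ((p : ℤ) ^ 2) ∣ (((a * b * c / p ^ t : ℕ) : ℤ) ^ 2) ^ (p - 1) - ((256 * (c * b + a * a) ^ 3 : ℕ) : ℤ) ^ (p - 1))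
    {i : ℕ} (hi : i + 1 ≤ (l - 1) / 2)
    (hcell : ∀ A : ℕ, A = p * (p - 1) * (p' / Nat.gcd p' t) →
      ∃ a₀ : ℕ, (∀ a, a < a₀ → (1 : ℤ) * ((p : ℕ) : ℤ) ^ a * (((p : ℕ) : ℤ) - 1) < ((A * l : ℕ) : ℤ)) ∧
        ((A * l : ℕ) : ℤ) ≤ 1 * ((p : ℕ) : ℤ) ^ a₀ * (((p : ℕ) : ℤ) - 1) ∧
        ((A * t : ℕ) : ℤ) - (((i : ℕ) : ℤ) + 1 + 1) * (((p : ℕ) : ℤ) ^ a₀ - (a₀ : ℤ) * ((A * l : ℕ) : ℤ)) <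
          ((A * l : ℕ) : ℤ) * (((((i : ℕ) : ℤ) + 1) ^ 2 * ((A * t : ℕ) : ℤ)
            - (((i : ℕ) : ℤ) + 1) * (((A * l + A * l / p - 1 : ℕ)) : ℤ)
            - (((i : ℕ) : ℤ) + 1 + 1) * (((A * l) / (p - 1) + 1 : ℕ) : ℤ)) / ((A * l : ℕ) : ℤ))) :
    letI := T.instFieldF; letI := T.instNumberFieldF; letI := T.instAlgebraF; letI := T.instFieldK
    letI := T.instNumberFieldK; letI := T.instAlgebraK; letI := T.instFieldFbar; letI := T.instAlgebraFbar
    letI := T.instAlgebraKFbar; letI := T.instIsElliptic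
    ∀ (M : Type) [Field M] [NumberField M]
      (archPk : ∀ (j : (thetaIndexOfInitial T.D).Label) (vQ : (thetaIndexOfInitial T.D).VQ),
        Set ((logShellsOfInitialDH T.D (analyticLogvVal T.K)).Packet j vQ))
      (archSub : ∀ (j : (thetaIndexOfInitial T.D).Label) (v : (thetaIndexOfInitial T.D).V),
        Set ((logShellsOfInitialDH T.D (analyticLogvVal T.K)).Packet j ((thetaIndexOfInitial T.D).over v)))
      (Ψ : ℤ → ∀ v : (thetaIndexOfInitial T.D).V, v ∈ (thetaIndexOfInitial T.D).Vbad →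
        Set ((logShellsOfInitialDH T.D (analyticLogvVal T.K)).StarPacket v))
      (act : ℤ → ∀ v : (thetaIndexOfInitial T.D).V, v ∈ (thetaIndexOfInitial T.D).Vbad →
        (logShellsOfInitialDH T.D (analyticLogvVal T.K)).StarPacket v →
          Module.End ℚ ((logShellsOfInitialDH T.D (analyticLogvVal T.K)).StarPacket v))
      (Mmod : ℤ → ∀ j : (thetaIndexOfInitial T.D).LabelStar, Set ((logShellsOfInitialDH T.D (analyticLogvVal T.K)).GlobalPacket j.1))
      (region : ℤ → ∀ j : (thetaIndexOfInitial T.D).LabelStar, FinDivisor M → ∀ vQ : (thetaIndexOfInitial T.D).VQ,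
        Set ((logShellsOfInitialDH T.D (analyticLogvVal T.K)).Packet j.1 vQ))
      (frobAdm : ℤ → ℤ → ∀ (j : (thetaIndexOfInitial T.D).Label) (vQ : (thetaIndexOfInitial T.D).VQ),
        Set ((logShellsOfInitialDH T.D (analyticLogvVal T.K)).Packet j vQ) → Prop)
      (frobLogvol : ℤ → ℤ → ∀ (j : (thetaIndexOfInitial T.D).Label) (vQ : (thetaIndexOfInitial T.D).VQ),
        Set ((logShellsOfInitialDH T.D (analyticLogvVal T.K)).Packet j vQ) → ℝ)
      (frobΨ : ℤ → ℤ → ∀ v : (thetaIndexOfInitial T.D).V, v ∈ (thetaIndexOfInitial T.D).Vbad →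
        Set ((logShellsOfInitialDH T.D (analyticLogvVal T.K)).StarPacket v))
      (frobMmod : ℤ → ℤ → ∀ j : (thetaIndexOfInitial T.D).LabelStar, Set ((logShellsOfInitialDH T.D (analyticLogvVal T.K)).GlobalPacket j.1))
      (unitImage : ℤ → ℤ → ℕ → ∀ (j : (thetaIndexOfInitial T.D).Label) (vQ : (thetaIndexOfInitial T.D).VQ),
        Set ((logShellsOfInitialDH T.D (analyticLogvVal T.K)).Packet j vQ))
      (ballImage : ℤ → ℤ → ∀ (j : (thetaIndexOfInitial T.D).Label) (vQ : (thetaIndexOfInitial T.D).VQ),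
        Set ((logShellsOfInitialDH T.D (analyticLogvVal T.K)).Packet j vQ))
      (thetaDiv : ℤ → ℤ → LgpDivisor M (thetaIndexOfInitial T.D).lstar)
      (n : ℤ) {HT : Type} {LogLink : HT → HT → Type} {IsFull : ∀ {s t : HT}, LogLink s t → Prop}
      (lat : LGPGaussianLogThetaLattice LogLink IsFull)
      {Frd : Type} {IsoF : Frd → Frd → Type} {Ob : Frd → Type} {realify : Frd → Frd} {Strip : Type}
      {IsoS : Strip → Strip → Type} {Mv : ∀ v : (thetaIndexOfInitial T.D).V, v ∈ (thetaIndexOfInitial T.D).Vbad → Type}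
      [∀ v h, Monoid (Mv v h)]
      (sig : GlobalLGPFrobenioidSignature (thetaIndexOfInitial T.D).lstar (thetaIndexOfInitial T.D).V
        (· ∈ (thetaIndexOfInitial T.D).Vbad) Frd IsoF Ob realify Strip IsoS Mv)
      (split : SplittingMonoids Mv) {ObΔ : Type} {N : ∀ v : (thetaIndexOfInitial T.D).V, v ∈ (thetaIndexOfInitial T.D).Vbad → Type}
      [∀ v h, Monoid (N v h)] (qData : QPilotData ObΔ N)
      (qK : ∀ v : (thetaIndexOfInitial T.D).V, v ∈ (thetaIndexOfInitial T.D).Vbad →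
        Set ((logShellsOfInitialDH T.D (analyticLogvVal T.K)).StarPacket v)),
      ¬ Cor312Vol.PilotKummerCompatHull
        (LatticeSituation.ofShells (logShellsOfInitialDH T.D (analyticLogvVal T.K)) M archPk archSub
          (summandPiecesPrM T.D (logvAnalyticVal_analyticLogvVal (K := T.K))).Adm (summandPiecesPrM T.D (logvAnalyticVal_analyticLogvVal (K := T.K))).logvol Ψ act Mmod region frobAdm frobLogvol
          frobΨ frobMmod unitImage ballImage thetaDiv)
        (settingPrVolSharpM T.D (logvAnalyticVal_analyticLogvVal (K := T.K)) (tOfIdeleData T.D (ideleDataOf T.D T.isVolumeInputOf))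
          (fun u x => tqM T.D (ratChar u) u (natCast_ratChar_mem u) (ideleDataOf T.D T.isVolumeInputOf) x) M archPk archSub Ψ act Mmod region n lat sig split qData
          (fun u x => tqM_ne_zero T.D (ratChar u) u (natCast_ratChar_mem u) (ideleDataOf T.D T.isVolumeInputOf) x)
          (GenuineM.finite_ratPlaces_under_S T.D).toFinset
          (fun u x hu => norm_tqM_eq_one_of_not_mem T.D (ratChar u) u (natCast_ratChar_mem u) (ideleDataOf T.D T.isVolumeInputOf) x
            fun hx => hu ((Set.Finite.mem_toFinset _).mpr ⟨x, hx⟩)))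
        (fun _ => Cor312.Setting.qRegion
          (settingPrVolSharpM T.D (logvAnalyticVal_analyticLogvVal (K := T.K)) (tOfIdeleData T.D (ideleDataOf T.D T.isVolumeInputOf))
          (fun u x => tqM T.D (ratChar u) u (natCast_ratChar_mem u) (ideleDataOf T.D T.isVolumeInputOf) x) M archPk archSub Ψ act Mmod region n lat sig split qData
          (fun u x => tqM_ne_zero T.D (ratChar u) u (natCast_ratChar_mem u) (ideleDataOf T.D T.isVolumeInputOf) x)
          (GenuineM.finite_ratPlaces_under_S T.D).toFinset
          (fun u x hu => norm_tqM_eq_one_of_not_mem T.D (ratChar u) u (natCast_ratChar_mem u) (ideleDataOf T.D T.isVolumeInputOf) x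
            fun hx => hu ((Set.Finite.mem_toFinset _).mpr ⟨x, hx⟩)))) qK := by
  classical
  letI := T.instFieldF; letI := T.instNumberFieldF; letI := T.instAlgebraF; letI := T.instFieldK
  letI := T.instNumberFieldK; letI := T.instAlgebraK; letI := T.instFieldFbar; letI := T.instAlgebraFbar
  letI := T.instAlgebraKFbar; letI := T.instIsElliptic
  intro M _ _ archPk archSub Ψ act Mmod region frobAdm frobLogvol frobΨ frobMmod unitImage ballImage thetaDiv n HT LogLink IsFull lat
    Frd IsoF Ob realify Strip IsoS Mv _ sig split ObΔ N _ qData qK hSH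
  have hp : p.Prime := by rcases hpq with ⟨h, -⟩ | ⟨h, -⟩ <;> rw [h] <;> norm_num
  have hp2 : p ≠ 2 := by rcases hpq with ⟨h, -⟩ | ⟨h, -⟩ <;> omega
  haveI hpfact : Fact p.Prime := ⟨hp⟩
  set pp : Nat.Primes := ⟨p, hp⟩ with hpp
  have hpq' : ((pp : ℕ) = 3 ∧ p' = 5) ∨ ((pp : ℕ) = 5 ∧ p' = 3) := hpq
  have hv : 1 ≤ t := ht
  -- the EXACT type and different on the K fibre (abc-iut-W-neg-2 / abc-iut-w5-d180), transported to the M members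
  have hK := GenuineK.absRamificationIdx_kOf_eq_wildUnit_of_triple habc T pp hpq' hpl hv hdvd hndvd hpt hD1 hD2
  have hKd := GenuineK.differentOrd_kOf_eq_wildUnit_ratPoint T pp hpq' hpl ht hpt
    (RadTriple.ord_jInv_eq_neg_two_mul habc hp hp2 hv hdvd hndvd) (RadTriple.unit_test_of_dvd_of_not_sq_dvd habc hp hp2 hv hdvd hD1 hD2)
  obtain ⟨y, hy⟩ := (thetaIndexOfInitial T.D).fibre_nonempty (Val.non u)
  have hloc : absRamificationIdx (ratChar u) (kOfM T.D (ratChar u) u (natCast_ratChar_mem u) ⟨y, hy⟩) =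
      p * (p - 1) * (p' / Nat.gcd p' t) * l :=
    WRowM.absRamificationIdx_kOfM_of_kFibre T u p hu hp (e₀ := p * (p - 1) * (p' / Nat.gcd p' t) * l) (fun x' => hK x') ⟨y, hy⟩
  have hdiff0 : differentOrd (ratChar u) (kOfM T.D (ratChar u) u (natCast_ratChar_mem u) ⟨y, hy⟩) =
      (((p * (p - 1) * (p' / Nat.gcd p' t) * l + p * (p - 1) * (p' / Nat.gcd p' t) * l / p - 1 : ℕ)) : ℝ) /
        ((p * (p - 1) * (p' / Nat.gcd p' t) * l : ℕ) : ℝ) :=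
    WRowM.differentOrd_kOfM_of_kFibre T u p hu hp (fun x' => by rw [hKd x', hK x']) ⟨y, hy⟩
  have hdiff : differentOrd (ratChar u) (kOfM T.D (ratChar u) u (natCast_ratChar_mem u) ⟨y, hy⟩) =
      (((p * (p - 1) * (p' / Nat.gcd p' t) * l + p * (p - 1) * (p' / Nat.gcd p' t) * l / p - 1 : ℕ)) : ℝ) /
        (absRamificationIdx (ratChar u) (kOfM T.D (ratChar u) u (natCast_ratChar_mem u) ⟨y, hy⟩) : ℝ) := by
    rw [hloc]; exact hdiff0
  -- `v_p(abc) = t`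
  have habc0 : a * b * c ≠ 0 := by
    have ha : 0 < a := habc.1; have hb : 0 < b := habc.2.1; have hc : 0 < c := by have := habc.2.2.1; omega
    positivity
  have hfac : (a * b * c).factorization p = t := by
    have h1 := (hp.pow_dvd_iff_le_factorization habc0).mp hdvd
    have h2 : ¬ t + 1 ≤ (a * b * c).factorization p := fun h => hndvd ((hp.pow_dvd_iff_le_factorization habc0).mpr h)
    omega
  obtain ⟨a₀, hlo, hhi, hlt0⟩ := hcell (p * (p - 1) * (p' / Nat.gcd p' t)) rfl
  exact WRowM.not_licence_triple_of_cellLt_wildMember habc T u p hu hp2 hpl (dvd_trans (dvd_pow_self p ht.ne') hdvd)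
    (e₀ := p * (p - 1) * (p' / Nat.gcd p' t) * l) (P := p * (p - 1) * (p' / Nat.gcd p' t) * t) (i := i) (a₀ := a₀)
    (d₀ := p * (p - 1) * (p' / Nat.gcd p' t) * l + p * (p - 1) * (p' / Nat.gcd p' t) * l / p - 1)
    ⟨y, hy⟩ hloc hdiff (by rw [hfac]; ring) hi hlo hhi hlt0
    (logvAnalyticVal_analyticLogvVal (K := T.K)) (ideleDataOf T.D T.isVolumeInputOf) M archPk archSub Ψ act Mmod region n lat sig split qData
    (fun u x => tqM_ne_zero T.D (ratChar u) u (natCast_ratChar_mem u) (ideleDataOf T.D T.isVolumeInputOf) x)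
    (GenuineM.finite_ratPlaces_under_S T.D).toFinset
    (fun u x hu => norm_tqM_eq_one_of_not_mem T.D (ratChar u) u (natCast_ratChar_mem u) (ideleDataOf T.D T.isVolumeInputOf) x
      fun hx => hu ((Set.Finite.mem_toFinset _).mpr ⟨x, hx⟩))
    (licence_of_pilotKummerCompatHull
      (LatticeSituation.ofShells (logShellsOfInitialDH T.D (analyticLogvVal T.K)) M archPk archSub
        (summandPiecesPrM T.D (logvAnalyticVal_analyticLogvVal (K := T.K))).Adm
        (summandPiecesPrM T.D (logvAnalyticVal_analyticLogvVal (K := T.K))).logvol Ψ act Mmod region frobAdm frobLogvol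
        frobΨ frobMmod unitImage ballImage thetaDiv)
      _ _ qK (fun _ _ => rfl) hSH)

end Summit.ABC.IUTFork.Conditional

end
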